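import Literature.Analysis.FluidPDE.PassiveVectorTensorDuality
import HarnessLib

/-!
# Antisymmetry of the Fourier transport flux at `H¹` level

Analysis/FluidPDE proof-support file (everything proved; no definitions, no named facts). For a
bounded measurable weakly divergence-free carrier `c : 𝕋^d → ℝ^d` and two fields `u, v ∈ L²(𝕋^d; ℝ^d)`
whose Fourier coefficients are square-summable with the weight `|k|²` (i.e. `u, v ∈ H¹` on the
Fourier side), the full Fourier transport flux
`∑ₖ Re ∑ⱼ 2πi kⱼ (⟪𝓕(cⱼ u)(k), v̂(k)⟫ − ⟪û(k), 𝓕(cⱼ v)(k)⟫)`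
vanishes: this is the `H¹` (density) form of the antisymmetry of the trilinear form
`∫⟪Φ, (c·∇)Ψ⟫ + ∫⟪Ψ, (c·∇)Φ⟫ = 0` (`Torus.integral_inner_convect_add_swap_eq_zero`, smooth `Φ, Ψ`;
Kuksin–Shirikyan 2012, Prop. 2.1.7, (2.11)–(2.12) `b(u,v,w) = −b(u,w,v)`; Robinson–Rodrigo–Sadowski
2016, §4.1–§4.2, Galerkin truncations and the remainder (4.20)).

* `Torus.sum_re_fourierFlux_eq` — the partial sums over the frequency balls ARE the cross transport
  pairings against the truncations: `∑_{|k|≤N} Re ∑ⱼ 2πikⱼ(⟪𝓕(cⱼu),v̂⟫ − ⟪û,𝓕(cⱼv)⟫)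
  = ∫⟪u,(c·∇)P_N v⟫ + ∫⟪v,(c·∇)P_N u⟫` (`integral_inner_convect_fourierTruncate_eq_sum` twice and
  `Re(2πikⱼ · conj z) = −Re(2πikⱼ · z)`);
* `Torus.tendsto_sum_re_fourierFlux` — these partial sums tend to `0` (the pairing is the remainder of
  `integral_inner_convect_fourierTruncate_add_swap`, of size
  `≤ d·M(‖u − P_Nu‖₂‖∇P_Nv‖₂ + ‖v − P_Nv‖₂‖∇P_Nu‖₂)`, and `‖∇P_N v‖₂² ≤ 4π²∑|k|²‖v̂(k)‖² < ∞`);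
* `Torus.summable_re_fourierFlux` — the mode family is summable (AM–GM against the two `H¹` sums and
  Parseval for `cⱼu, cⱼv ∈ L²`);
* `Torus.hasSum_re_fourierFlux`, `Torus.tsum_re_fourierFlux_eq_zero` — **the flux sums to `0`**;
  `Torus.fluxAntisymm` — the same in the binder shape of the cell's crux text
  (`Cruxes/LagrangianRenormalisationStep/Lines/onelevel_Z_bricks.lean`, `fluxAntisymm_text`, Z1″);
* TWO CARRIERS (`c₁` on `u`, `c₂` on `v`; the cross flux of the two-problem duality Z1′):
  `Torus.sum_re_fourierFlux₂_eq` (partial sums = `∫⟪u,(c₁·∇)P_N v⟫ + ∫⟪v,(c₂·∇)P_N u⟫`, no limit taken),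
  `Torus.summable_re_fourierFlux₂` (the two-carrier mode family is summable under the same `H¹` sums),
  `Torus.tendsto_sum_re_fourierFlux₂` (its partial sums over the balls converge to the `tsum`).

Cell `ad-ideate`, K1L_D (stmt-AnomalousDissipation-27980), lead memo L7 brick Z1″ (the equal-carrier
part of the two-problem duality flux vanishes only after the `k`-sum).

## Mathlib / tree search

Tree: `PassiveVectorTensorDuality` (`integral_inner_convect_fourierTruncate_eq_sum`,
`integral_inner_convect_add_swap_eq_zero`, `integral_inner_convect_fourierTruncate_add_swap`),
`StatisticalSolutionEnergyEq` (`Torus.eGradNormSq_fourierTruncate_le`), `TorusSpectralWeakDerivative`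
(`eGradNormSq_eq_tsum`), `TorusTrigPoly` (`tendsto_lintegral_enorm_sq_fourierTruncate_sub`,
`tendsto_freqBall_atTop`), `TorusVectorParseval` (`hasSum_sq_norm_mFourierCoeff_complexify`).
Mathlib: `MemLp.of_le_mul` (products `cⱼu ∈ L²`, private helpers), `HasSum.comp` with
`tendsto_freqBall_atTop`, `tendsto_nhds_unique`, `Summable.of_norm_bounded`, `ENNReal.ofReal_tsum_of_nonneg`.
Also public: `Torus.eGradNormSq_eq_ofReal_tsum_of_summable` (finite enstrophy from an `H¹` Fourier sum),
`Torus.tendsto_integral_norm_sq_sub_fourierTruncate_of_memLp` (`∫‖u − P_Nu‖² → 0` for `u ∈ L²`).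

## References

* S. Kuksin, A. Shirikyan, *Mathematics of two-dimensional turbulence* (CUP 2012), Prop. 2.1.7,
  (2.11)–(2.12). [`KuksinShirikyan2012`]
* J. C. Robinson, J. L. Rodrigo, W. Sadowski, *The three-dimensional Navier–Stokes equations*
  (CUP 2016), §4.1–§4.2, Lemma 4.1, (4.20). [`RobinsonRodrigoSadowski2016`]
-/

noncomputable section

open MeasureTheory Set Filter Function TopologicalSpace Complex UnitAddTorus
open scoped ENNReal NNReal InnerProductSpace Topology ComplexConjugate

namespace Literature.Analysis.FluidPDE

namespace Torus

variable {d : Type*} [Fintype d] [DecidableEq d]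

section FluxAntisymm

/-! ## Products with a bounded carrier -/

omit [DecidableEq d] in
/-- A bounded measurable scalar component times an `L²` field is in `L²`. [folklore] -/
private theorem memLp_two_smul_apply_of_norm_le {c u : UnitAddTorus d → EuclideanSpace ℝ d} {M : ℝ}
    (hcM : ∀ x, ‖c x‖ ≤ M) (hc : Measurable c) (hu : MemLp u 2 volume) (j : d) :
    MemLp (fun x => c x j • u x) 2 volume := by
  have hcj : AEStronglyMeasurable (fun x => c x j) volume :=
    ((EuclideanSpace.proj j).continuous.measurable.comp hc).aestronglyMeasurable
  refine MemLp.of_le_mul (c := M) hu (hcj.smul hu.1) (ae_of_all _ fun x => ?_)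
  rw [norm_smul]
  refine mul_le_mul_of_nonneg_right ?_ (norm_nonneg _)
  rw [Real.norm_eq_abs]
  exact (FunctionSpaces.Torus.abs_apply_le_norm (c x) j).trans (hcM x)

omit [DecidableEq d] in
/-- A bounded measurable scalar component times an `L²` field is integrable. [folklore] -/
private theorem integrable_smul_apply_of_norm_le {c u : UnitAddTorus d → EuclideanSpace ℝ d} {M : ℝ}
    (hcM : ∀ x, ‖c x‖ ≤ M) (hc : Measurable c) (hu : MemLp u 2 volume) (j : d) :
    Integrable (fun x => c x j • u x) volume :=
  (memLp_two_smul_apply_of_norm_le hcM hc hu j).integrable one_le_two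

omit [DecidableEq d] in
/-- A bounded measurable field on the torus is integrable. [folklore] -/
private theorem integrable_of_norm_le {c : UnitAddTorus d → EuclideanSpace ℝ d} {M : ℝ}
    (hcM : ∀ x, ‖c x‖ ≤ M) (hc : Measurable c) : Integrable c volume :=
  Integrable.of_bound hc.aestronglyMeasurable M (ae_of_all _ hcM)

/-! ## The partial sums are the cross transport pairings -/

omit [Fintype d] [DecidableEq d] in
/-- `Re(i a · conj z) = −Re(i a · z)` for real `a`: a purely imaginary factor flips the sign of the
real part under conjugation of the other factor. [folklore] -/
private theorem re_mul_I_mul_conj_eq_neg (a : ℝ) (z : ℂ) :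
    ((a : ℂ) * I * conj z).re = -(((a : ℂ) * I * z).re) := by
  simp [Complex.mul_re, Complex.mul_im, Complex.conj_re, Complex.conj_im]

/-- **The partial sums of the flux are the cross transport pairings against the truncations**:
`∑_{|k|≤N} Re ∑ⱼ 2πikⱼ(⟪𝓕(cⱼu)(k), v̂(k)⟫ − ⟪û(k), 𝓕(cⱼv)(k)⟫) = ∫⟪u,(c·∇)P_N v⟫ + ∫⟪v,(c·∇)P_N u⟫`
whenever the products `cⱼu`, `cⱼv` are integrable. [cite: RobinsonRodrigoSadowski2016, §4.1 (Galerkin truncations)] -/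
theorem sum_re_fourierFlux_eq {c u v : UnitAddTorus d → EuclideanSpace ℝ d}
    (hcu : ∀ j, Integrable (fun x => c x j • u x) volume)
    (hcv : ∀ j, Integrable (fun x => c x j • v x) volume) (N : ℕ) :
    ∑ k ∈ FunctionSpaces.Torus.freqBall N, (∑ j, (2 * Real.pi * I * (k j)) *
        (⟪mFourierCoeff (FunctionSpaces.EuclideanSpace.complexify ∘ fun x => c x j • u x) k,
            mFourierCoeff (FunctionSpaces.EuclideanSpace.complexify ∘ v) k⟫_ℂ -
          ⟪mFourierCoeff (FunctionSpaces.EuclideanSpace.complexify ∘ u) k,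
            mFourierCoeff (FunctionSpaces.EuclideanSpace.complexify ∘ fun x => c x j • v x) k⟫_ℂ)).re =
      (∫ x, ⟪u x, FunctionSpaces.Torus.convect c (FunctionSpaces.Torus.fourierTruncate N v) x⟫_ℝ) +
        ∫ x, ⟪v x, FunctionSpaces.Torus.convect c (FunctionSpaces.Torus.fourierTruncate N u) x⟫_ℝ := by
  rw [integral_inner_convect_fourierTruncate_eq_sum hcu v N,
    integral_inner_convect_fourierTruncate_eq_sum hcv u N, ← Finset.sum_add_distrib]
  refine Finset.sum_congr rfl fun k _ => ?_
  rw [← Complex.add_re]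
  simp only [mul_sub, Finset.sum_sub_distrib, Complex.sub_re, Complex.add_re, Complex.re_sum]
  rw [sub_eq_add_neg, ← Finset.sum_neg_distrib]
  congr 1
  refine Finset.sum_congr rfl fun j _ => ?_
  rw [← inner_conj_symm, show (2 * (Real.pi : ℂ) * I * (k j : ℂ)) = ((2 * Real.pi * (k j : ℝ) : ℝ) : ℂ) * I by
    push_cast; ring, re_mul_I_mul_conj_eq_neg, neg_neg]

/-! ## The partial sums tend to zero -/

omit [DecidableEq d] in
/-- `∫‖u − P_N u‖² → 0` for `u ∈ L²` (real-integral form of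
`FunctionSpaces.Torus.tendsto_lintegral_enorm_sq_fourierTruncate_sub`). [cite: RobinsonRodrigoSadowski2016, Lemma 4.1, p. 74] -/
theorem tendsto_integral_norm_sq_sub_fourierTruncate_of_memLp [DecidableEq d]
    {u : UnitAddTorus d → EuclideanSpace ℝ d} (hu : MemLp u 2 volume) :
    Tendsto (fun N => ∫ x, ‖u x - FunctionSpaces.Torus.fourierTruncate N u x‖ ^ 2) atTop (𝓝 0) := by
  have h := FunctionSpaces.Torus.tendsto_lintegral_enorm_sq_fourierTruncate_sub hu
  have h' := (ENNReal.tendsto_toReal ENNReal.zero_ne_top).comp h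
  rw [ENNReal.toReal_zero] at h'
  refine h'.congr fun N => ?_
  have hmeas : AEStronglyMeasurable (fun x => ‖u x - FunctionSpaces.Torus.fourierTruncate N u x‖ ^ 2) volume :=
    ((hu.1.sub (FunctionSpaces.Torus.continuous_fourierTruncate N u).aestronglyMeasurable).norm.pow 2)
  rw [Function.comp_apply, integral_eq_lintegral_of_nonneg_ae (Eventually.of_forall fun x => by
      positivity) hmeas]
  congr 1
  refine lintegral_congr fun x => ?_
  rw [norm_sub_rev, ← ofReal_norm, ← ENNReal.ofReal_pow (norm_nonneg _)]

omit [DecidableEq d] in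
/-- **Finite spectral enstrophy from an `H¹` Fourier sum**: if `∑ |k|² ‖v̂(k)‖² < ∞` then
`eGradNormSq v = 4π² ∑ |k|² ‖v̂(k)‖²` is finite, with this value (Parseval for the gradient,
Grafakos Prop. 3.2.7 (3) with `𝓕(∂ⱼv)(k) = 2πikⱼv̂(k)`). [cite: Grafakos2014, Prop. 3.2.7 (3)] -/
theorem eGradNormSq_eq_ofReal_tsum_of_summable {v : UnitAddTorus d → EuclideanSpace ℝ d}
    (hv1 : Summable fun k : d → ℤ =>
      FunctionSpaces.Torus.freqNormSq k * ‖mFourierCoeff (FunctionSpaces.EuclideanSpace.complexify ∘ v) k‖ ^ 2) :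
    FunctionSpaces.Torus.eGradNormSq v = ENNReal.ofReal (4 * Real.pi ^ 2 *
      ∑' k : d → ℤ, FunctionSpaces.Torus.freqNormSq k *
        ‖mFourierCoeff (FunctionSpaces.EuclideanSpace.complexify ∘ v) k‖ ^ 2) := by
  have hnn : ∀ k : d → ℤ, 0 ≤ FunctionSpaces.Torus.freqNormSq k *
      ‖mFourierCoeff (FunctionSpaces.EuclideanSpace.complexify ∘ v) k‖ ^ 2 := fun k =>
    mul_nonneg (Finset.sum_nonneg fun _ _ => sq_nonneg _) (sq_nonneg _)
  rw [FunctionSpaces.Torus.eGradNormSq_eq_tsum]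
  conv_rhs => rw [ENNReal.ofReal_mul (by positivity : (0 : ℝ) ≤ 4 * Real.pi ^ 2),
    ENNReal.ofReal_tsum_of_nonneg hnn hv1]
  congr 1
  refine tsum_congr fun k => ?_
  have hfk : 0 ≤ FunctionSpaces.Torus.freqNormSq k := Finset.sum_nonneg fun _ _ => sq_nonneg _
  rw [ENNReal.ofReal_mul hfk, ← ofReal_norm, ← ENNReal.ofReal_pow (norm_nonneg _)]

/-- **The partial sums of the flux tend to zero** for a bounded measurable weakly divergence-free
carrier and `u, v ∈ L²` with `H¹` Fourier sums: they equal the remainder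
`∫⟪u − P_Nu,(c·∇)P_Nv⟫ + ∫⟪v − P_Nv,(c·∇)P_Nu⟫`, of size `≤ d·M(‖u − P_Nu‖₂‖∇P_Nv‖₂ + ‖v − P_Nv‖₂‖∇P_Nu‖₂)`
with `‖∇P_N v‖₂ ≤ ‖∇v‖₂ < ∞`. [cite: RobinsonRodrigoSadowski2016, §4.2 (4.20)] -/
theorem tendsto_sum_re_fourierFlux {c u v : UnitAddTorus d → EuclideanSpace ℝ d} {M : ℝ}
    (hcM : ∀ x, ‖c x‖ ≤ M) (hc : Measurable c) (hcdiv : FunctionSpaces.Torus.IsWeaklyDivFree c)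
    (hu : MemLp u 2 volume) (hv : MemLp v 2 volume)
    (hu1 : Summable fun k : d → ℤ =>
      FunctionSpaces.Torus.freqNormSq k * ‖mFourierCoeff (FunctionSpaces.EuclideanSpace.complexify ∘ u) k‖ ^ 2)
    (hv1 : Summable fun k : d → ℤ =>
      FunctionSpaces.Torus.freqNormSq k * ‖mFourierCoeff (FunctionSpaces.EuclideanSpace.complexify ∘ v) k‖ ^ 2) :
    Tendsto (fun N => ∑ k ∈ FunctionSpaces.Torus.freqBall N, (∑ j, (2 * Real.pi * I * (k j)) *
        (⟪mFourierCoeff (FunctionSpaces.EuclideanSpace.complexify ∘ fun x => c x j • u x) k,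
            mFourierCoeff (FunctionSpaces.EuclideanSpace.complexify ∘ v) k⟫_ℂ -
          ⟪mFourierCoeff (FunctionSpaces.EuclideanSpace.complexify ∘ u) k,
            mFourierCoeff (FunctionSpaces.EuclideanSpace.complexify ∘ fun x => c x j • v x) k⟫_ℂ)).re)
      atTop (𝓝 0) := by
  have hM : 0 ≤ M := (norm_nonneg _).trans (hcM 0)
  have hci : Integrable c volume := integrable_of_norm_le hcM hc
  have hcu := integrable_smul_apply_of_norm_le hcM hc hu
  have hcv := integrable_smul_apply_of_norm_le hcM hc hv
  have hui : Integrable u volume := hu.integrable one_le_two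
  have hvi : Integrable v volume := hv.integrable one_le_two
  -- the finite enstrophies
  set Gu : ℝ := 4 * Real.pi ^ 2 * ∑' k : d → ℤ, FunctionSpaces.Torus.freqNormSq k *
    ‖mFourierCoeff (FunctionSpaces.EuclideanSpace.complexify ∘ u) k‖ ^ 2 with hGu
  set Gv : ℝ := 4 * Real.pi ^ 2 * ∑' k : d → ℤ, FunctionSpaces.Torus.freqNormSq k *
    ‖mFourierCoeff (FunctionSpaces.EuclideanSpace.complexify ∘ v) k‖ ^ 2 with hGv
  have hGu0 : 0 ≤ Gu := mul_nonneg (by positivity) (tsum_nonneg fun k =>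
    mul_nonneg (Finset.sum_nonneg fun _ _ => sq_nonneg _) (sq_nonneg _))
  have hGv0 : 0 ≤ Gv := mul_nonneg (by positivity) (tsum_nonneg fun k =>
    mul_nonneg (Finset.sum_nonneg fun _ _ => sq_nonneg _) (sq_nonneg _))
  have hDu : ∀ N, (FunctionSpaces.Torus.eGradNormSq (FunctionSpaces.Torus.fourierTruncate N u)).toReal ≤ Gu := by
    intro N
    have h1 := eGradNormSq_fourierTruncate_le hui N
    rw [eGradNormSq_eq_ofReal_tsum_of_summable hu1] at h1
    exact (ENNReal.toReal_mono ENNReal.ofReal_ne_top h1).trans_eq (ENNReal.toReal_ofReal hGu0)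
  have hDv : ∀ N, (FunctionSpaces.Torus.eGradNormSq (FunctionSpaces.Torus.fourierTruncate N v)).toReal ≤ Gv := by
    intro N
    have h1 := eGradNormSq_fourierTruncate_le hvi N
    rw [eGradNormSq_eq_ofReal_tsum_of_summable hv1] at h1
    exact (ENNReal.toReal_mono ENNReal.ofReal_ne_top h1).trans_eq (ENNReal.toReal_ofReal hGv0)
  -- the tails
  have htu := tendsto_integral_norm_sq_sub_fourierTruncate_of_memLp hu
  have htv := tendsto_integral_norm_sq_sub_fourierTruncate_of_memLp hv
  -- the bound `B N → 0`
  set B : ℕ → ℝ := fun N => Fintype.card d * M *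
    (Real.sqrt (∫ x, ‖u x - FunctionSpaces.Torus.fourierTruncate N u x‖ ^ 2) * Real.sqrt Gv +
      Real.sqrt (∫ x, ‖v x - FunctionSpaces.Torus.fourierTruncate N v x‖ ^ 2) * Real.sqrt Gu) with hB
  have hB0 : Tendsto B atTop (𝓝 0) := by
    have h1 : Tendsto (fun N => Real.sqrt (∫ x, ‖u x - FunctionSpaces.Torus.fourierTruncate N u x‖ ^ 2))
        atTop (𝓝 0) := by
      have := (Real.continuous_sqrt.tendsto 0).comp htu
      rwa [Real.sqrt_zero] at this
    have h2 : Tendsto (fun N => Real.sqrt (∫ x, ‖v x - FunctionSpaces.Torus.fourierTruncate N v x‖ ^ 2))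
        atTop (𝓝 0) := by
      have := (Real.continuous_sqrt.tendsto 0).comp htv
      rwa [Real.sqrt_zero] at this
    have h3 := ((h1.mul_const (Real.sqrt Gv)).add (h2.mul_const (Real.sqrt Gu))).const_mul
      ((Fintype.card d : ℝ) * M)
    simpa [hB] using h3
  -- squeeze
  refine squeeze_zero_norm (fun N => ?_) hB0
  obtain ⟨heq, hle⟩ := integral_inner_convect_fourierTruncate_add_swap hci hcdiv hM (ae_of_all _ hcM)
    hu hv hcu hcv N
  rw [Real.norm_eq_abs, sum_re_fourierFlux_eq hcu hcv N, heq]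
  refine hle.trans ?_
  have hC : 0 ≤ (Fintype.card d : ℝ) * M := mul_nonneg (Nat.cast_nonneg _) hM
  refine mul_le_mul_of_nonneg_left (add_le_add ?_ ?_) hC
  · exact mul_le_mul_of_nonneg_left (Real.sqrt_le_sqrt (hDv N)) (Real.sqrt_nonneg _)
  · exact mul_le_mul_of_nonneg_left (Real.sqrt_le_sqrt (hDu N)) (Real.sqrt_nonneg _)

/-! ## Summability of the mode family and the value of the sum -/

omit [Fintype d] [DecidableEq d] in
/-- `|Re(2πi a ⟪X, Y⟫)| ≤ 2π|a|‖X‖‖Y‖`. [folklore] -/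
private theorem abs_re_two_pi_I_mul_inner_le {E : Type*} [NormedAddCommGroup E] [InnerProductSpace ℂ E]
    (a : ℝ) (X Y : E) :
    |((2 * Real.pi * I * (a : ℂ)) * ⟪X, Y⟫_ℂ).re| ≤ 2 * Real.pi * |a| * ‖X‖ * ‖Y‖ := by
  refine (Complex.abs_re_le_norm _).trans ?_
  rw [norm_mul]
  have h1 : ‖(2 * Real.pi * I * (a : ℂ))‖ = 2 * Real.pi * |a| := by
    rw [norm_mul, norm_mul, norm_mul, Complex.norm_I, mul_one, Complex.norm_real, Real.norm_eq_abs,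
      Complex.norm_ofNat, Complex.norm_real, Real.norm_eq_abs, abs_of_pos Real.pi_pos]
  rw [h1, mul_assoc (2 * Real.pi * |a|)]
  exact mul_le_mul_of_nonneg_left (norm_inner_le_norm X Y) (by positivity)

omit [DecidableEq d] in
/-- **The mode family of the flux is summable** (`u, v ∈ L²` with `H¹` Fourier sums, bounded measurable
carrier): termwise `|Re ∑ⱼ 2πikⱼ(⟪𝓕(cⱼu),v̂⟫ − ⟪û,𝓕(cⱼv)⟫)| ≤ π ∑ⱼ (kⱼ²‖v̂‖² + ‖𝓕(cⱼu)‖² + kⱼ²‖û‖² + ‖𝓕(cⱼv)‖²)`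
(AM–GM), and the right-hand side is summable by the hypotheses and Parseval for `cⱼu, cⱼv ∈ L²`.
[cite: RobinsonRodrigoSadowski2016, §4.1] -/
theorem summable_re_fourierFlux {c u v : UnitAddTorus d → EuclideanSpace ℝ d} {M : ℝ}
    (hcM : ∀ x, ‖c x‖ ≤ M) (hc : Measurable c)
    (hu : MemLp u 2 volume) (hv : MemLp v 2 volume)
    (hu1 : Summable fun k : d → ℤ =>
      FunctionSpaces.Torus.freqNormSq k * ‖mFourierCoeff (FunctionSpaces.EuclideanSpace.complexify ∘ u) k‖ ^ 2)
    (hv1 : Summable fun k : d → ℤ =>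
      FunctionSpaces.Torus.freqNormSq k * ‖mFourierCoeff (FunctionSpaces.EuclideanSpace.complexify ∘ v) k‖ ^ 2) :
    Summable fun k : d → ℤ => (∑ j, (2 * Real.pi * I * (k j)) *
        (⟪mFourierCoeff (FunctionSpaces.EuclideanSpace.complexify ∘ fun x => c x j • u x) k,
            mFourierCoeff (FunctionSpaces.EuclideanSpace.complexify ∘ v) k⟫_ℂ -
          ⟪mFourierCoeff (FunctionSpaces.EuclideanSpace.complexify ∘ u) k,
            mFourierCoeff (FunctionSpaces.EuclideanSpace.complexify ∘ fun x => c x j • v x) k⟫_ℂ)).re := by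
  -- notation
  set Fu : (d → ℤ) → EuclideanSpace ℂ d := fun k => mFourierCoeff (FunctionSpaces.EuclideanSpace.complexify ∘ u) k
    with hFu
  set Fv : (d → ℤ) → EuclideanSpace ℂ d := fun k => mFourierCoeff (FunctionSpaces.EuclideanSpace.complexify ∘ v) k
    with hFv
  set Fcu : d → (d → ℤ) → EuclideanSpace ℂ d := fun j k =>
    mFourierCoeff (FunctionSpaces.EuclideanSpace.complexify ∘ fun x => c x j • u x) k with hFcu
  set Fcv : d → (d → ℤ) → EuclideanSpace ℂ d := fun j k =>
    mFourierCoeff (FunctionSpaces.EuclideanSpace.complexify ∘ fun x => c x j • v x) k with hFcv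
  -- the dominating family
  set g : (d → ℤ) → ℝ := fun k => Real.pi * ∑ j, (((k j : ℝ) ^ 2 * ‖Fv k‖ ^ 2 + ‖Fcu j k‖ ^ 2) +
    ((k j : ℝ) ^ 2 * ‖Fu k‖ ^ 2 + ‖Fcv j k‖ ^ 2)) with hg
  have hPu : ∀ j, Summable fun k : d → ℤ => ‖Fcu j k‖ ^ 2 := fun j =>
    (FunctionSpaces.Torus.hasSum_sq_norm_mFourierCoeff_complexify
      (memLp_two_smul_apply_of_norm_le hcM hc hu j)).summable
  have hPv : ∀ j, Summable fun k : d → ℤ => ‖Fcv j k‖ ^ 2 := fun j =>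
    (FunctionSpaces.Torus.hasSum_sq_norm_mFourierCoeff_complexify
      (memLp_two_smul_apply_of_norm_le hcM hc hv j)).summable
  have hku : ∀ j, Summable fun k : d → ℤ => (k j : ℝ) ^ 2 * ‖Fu k‖ ^ 2 := by
    intro j
    refine hu1.of_nonneg_of_le (fun k => by positivity) fun k => ?_
    refine mul_le_mul_of_nonneg_right ?_ (sq_nonneg _)
    exact Finset.single_le_sum (f := fun i => ((k i : ℝ)) ^ 2) (fun i _ => sq_nonneg _) (Finset.mem_univ j)
  have hkv : ∀ j, Summable fun k : d → ℤ => (k j : ℝ) ^ 2 * ‖Fv k‖ ^ 2 := by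
    intro j
    refine hv1.of_nonneg_of_le (fun k => by positivity) fun k => ?_
    refine mul_le_mul_of_nonneg_right ?_ (sq_nonneg _)
    exact Finset.single_le_sum (f := fun i => ((k i : ℝ)) ^ 2) (fun i _ => sq_nonneg _) (Finset.mem_univ j)
  have hgs : Summable g := by
    refine (summable_sum fun j _ => ((hkv j).add (hPu j)).add ((hku j).add (hPv j))).mul_left Real.pi
  refine Summable.of_norm_bounded hgs fun k => ?_
  rw [Real.norm_eq_abs, Complex.re_sum]
  refine (Finset.abs_sum_le_sum_abs _ _).trans ?_
  simp only [hg, Finset.mul_sum]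
  refine Finset.sum_le_sum fun j _ => ?_
  rw [mul_sub, Complex.sub_re]
  refine (abs_sub _ _).trans ?_
  have h1 := abs_re_two_pi_I_mul_inner_le ((k j : ℤ) : ℝ) (Fcu j k) (Fv k)
  have h2 := abs_re_two_pi_I_mul_inner_le ((k j : ℤ) : ℝ) (Fu k) (Fcv j k)
  have e1 : ((((k j : ℤ) : ℝ) : ℂ)) = ((k j : ℤ) : ℂ) := by norm_cast
  rw [e1] at h1 h2
  refine (add_le_add h1 h2).trans ?_
  -- AM–GM twice
  have am1 : 2 * Real.pi * |((k j : ℤ) : ℝ)| * ‖Fcu j k‖ * ‖Fv k‖ ≤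
      Real.pi * (((k j : ℝ)) ^ 2 * ‖Fv k‖ ^ 2 + ‖Fcu j k‖ ^ 2) := by
    have := two_mul_le_add_sq (|((k j : ℤ) : ℝ)| * ‖Fv k‖) ‖Fcu j k‖
    rw [mul_pow, sq_abs] at this
    nlinarith [Real.pi_pos, this]
  have am2 : 2 * Real.pi * |((k j : ℤ) : ℝ)| * ‖Fu k‖ * ‖Fcv j k‖ ≤
      Real.pi * (((k j : ℝ)) ^ 2 * ‖Fu k‖ ^ 2 + ‖Fcv j k‖ ^ 2) := by
    have := two_mul_le_add_sq (|((k j : ℤ) : ℝ)| * ‖Fu k‖) ‖Fcv j k‖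
    rw [mul_pow, sq_abs] at this
    nlinarith [Real.pi_pos, this]
  linarith

/-- **The Fourier transport flux sums to zero** (`HasSum` form): for a bounded measurable weakly
divergence-free carrier `c` and `u, v ∈ L²(𝕋^d; ℝ^d)` with `∑|k|²‖û(k)‖² < ∞`, `∑|k|²‖v̂(k)‖² < ∞`,
`HasSum (k ↦ Re ∑ⱼ 2πikⱼ(⟪𝓕(cⱼu)(k), v̂(k)⟫ − ⟪û(k), 𝓕(cⱼv)(k)⟫)) 0` — the `H¹` form of
`∫⟪Φ,(c·∇)Ψ⟫ + ∫⟪Ψ,(c·∇)Φ⟫ = 0`. [cite: KuksinShirikyan2012, Prop. 2.1.7 (2.11)] -/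
theorem hasSum_re_fourierFlux {c u v : UnitAddTorus d → EuclideanSpace ℝ d} {M : ℝ}
    (hcM : ∀ x, ‖c x‖ ≤ M) (hc : Measurable c) (hcdiv : FunctionSpaces.Torus.IsWeaklyDivFree c)
    (hu : MemLp u 2 volume) (hv : MemLp v 2 volume)
    (hu1 : Summable fun k : d → ℤ =>
      FunctionSpaces.Torus.freqNormSq k * ‖mFourierCoeff (FunctionSpaces.EuclideanSpace.complexify ∘ u) k‖ ^ 2)
    (hv1 : Summable fun k : d → ℤ =>
      FunctionSpaces.Torus.freqNormSq k * ‖mFourierCoeff (FunctionSpaces.EuclideanSpace.complexify ∘ v) k‖ ^ 2) :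
    HasSum (fun k : d → ℤ => (∑ j, (2 * Real.pi * I * (k j)) *
        (⟪mFourierCoeff (FunctionSpaces.EuclideanSpace.complexify ∘ fun x => c x j • u x) k,
            mFourierCoeff (FunctionSpaces.EuclideanSpace.complexify ∘ v) k⟫_ℂ -
          ⟪mFourierCoeff (FunctionSpaces.EuclideanSpace.complexify ∘ u) k,
            mFourierCoeff (FunctionSpaces.EuclideanSpace.complexify ∘ fun x => c x j • v x) k⟫_ℂ)).re) 0 := by
  have hs := summable_re_fourierFlux hcM hc hu hv hu1 hv1
  have hlim := hs.hasSum.comp FunctionSpaces.Torus.tendsto_freqBall_atTop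
  have h0 := tendsto_sum_re_fourierFlux hcM hc hcdiv hu hv hu1 hv1
  have heq := tendsto_nhds_unique hlim h0
  rw [← heq]
  exact hs.hasSum

/-- **The Fourier transport flux sums to zero** (`tsum` form). [cite: KuksinShirikyan2012, Prop. 2.1.7 (2.11)] -/
theorem tsum_re_fourierFlux_eq_zero {c u v : UnitAddTorus d → EuclideanSpace ℝ d} {M : ℝ}
    (hcM : ∀ x, ‖c x‖ ≤ M) (hc : Measurable c) (hcdiv : FunctionSpaces.Torus.IsWeaklyDivFree c)
    (hu : MemLp u 2 volume) (hv : MemLp v 2 volume)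
    (hu1 : Summable fun k : d → ℤ =>
      FunctionSpaces.Torus.freqNormSq k * ‖mFourierCoeff (FunctionSpaces.EuclideanSpace.complexify ∘ u) k‖ ^ 2)
    (hv1 : Summable fun k : d → ℤ =>
      FunctionSpaces.Torus.freqNormSq k * ‖mFourierCoeff (FunctionSpaces.EuclideanSpace.complexify ∘ v) k‖ ^ 2) :
    (∑' k : d → ℤ, (∑ j, (2 * Real.pi * I * (k j)) *
        (⟪mFourierCoeff (FunctionSpaces.EuclideanSpace.complexify ∘ fun x => c x j • u x) k,
            mFourierCoeff (FunctionSpaces.EuclideanSpace.complexify ∘ v) k⟫_ℂ -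
          ⟪mFourierCoeff (FunctionSpaces.EuclideanSpace.complexify ∘ u) k,
            mFourierCoeff (FunctionSpaces.EuclideanSpace.complexify ∘ fun x => c x j • v x) k⟫_ℂ)).re) = 0 :=
  (hasSum_re_fourierFlux hcM hc hcdiv hu hv hu1 hv1).tsum_eq

/-- **Z1″ in the binder shape of the cell's crux text** (`onelevel_Z_bricks.lean`, `fluxAntisymm_text`):
antisymmetry of the Fourier transport flux at `H¹` level. [cite: KuksinShirikyan2012, Prop. 2.1.7 (2.11)] -/
theorem fluxAntisymm : ∀ {c u v : UnitAddTorus d → EuclideanSpace ℝ d} {M : ℝ},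
    (∀ x, ‖c x‖ ≤ M) → Measurable c → FunctionSpaces.Torus.IsWeaklyDivFree c → MemLp u 2 volume → MemLp v 2 volume →
    Summable (fun k : d → ℤ => FunctionSpaces.Torus.freqNormSq k *
      ‖mFourierCoeff (FunctionSpaces.EuclideanSpace.complexify ∘ u) k‖ ^ 2) →
    Summable (fun k : d → ℤ => FunctionSpaces.Torus.freqNormSq k *
      ‖mFourierCoeff (FunctionSpaces.EuclideanSpace.complexify ∘ v) k‖ ^ 2) →
    (∑' k : d → ℤ, (∑ j, (2 * Real.pi * I * (k j)) *
        (⟪mFourierCoeff (FunctionSpaces.EuclideanSpace.complexify ∘ fun x => c x j • u x) k,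
            mFourierCoeff (FunctionSpaces.EuclideanSpace.complexify ∘ v) k⟫_ℂ -
          ⟪mFourierCoeff (FunctionSpaces.EuclideanSpace.complexify ∘ u) k,
            mFourierCoeff (FunctionSpaces.EuclideanSpace.complexify ∘ fun x => c x j • v x) k⟫_ℂ)).re) = 0 :=
  fun hcM hc hcdiv hu hv hu1 hv1 => tsum_re_fourierFlux_eq_zero hcM hc hcdiv hu hv hu1 hv1

end FluxAntisymm

/-! ## Two carriers: the cross flux of the two-problem duality (Z1′) -/

section TwoCarriers

/-- **Partial sums of the TWO-CARRIER flux are the cross transport pairings**: for carriers `c₁` (on `u`)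
and `c₂` (on `v`) with integrable products,
`∑_{|k|≤N} Re ∑ⱼ 2πikⱼ(⟪𝓕(c₁ⱼu)(k), v̂(k)⟫ − ⟪û(k), 𝓕(c₂ⱼv)(k)⟫) = ∫⟪u,(c₁·∇)P_N v⟫ + ∫⟪v,(c₂·∇)P_N u⟫`
(same computation as `sum_re_fourierFlux_eq`; nothing cancels here). [cite: RobinsonRodrigoSadowski2016, §4.1 (Galerkin truncations)] -/
theorem sum_re_fourierFlux₂_eq {c₁ c₂ u v : UnitAddTorus d → EuclideanSpace ℝ d}
    (hcu : ∀ j, Integrable (fun x => c₁ x j • u x) volume)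
    (hcv : ∀ j, Integrable (fun x => c₂ x j • v x) volume) (N : ℕ) :
    ∑ k ∈ FunctionSpaces.Torus.freqBall N, (∑ j, (2 * Real.pi * I * (k j)) *
        (⟪mFourierCoeff (FunctionSpaces.EuclideanSpace.complexify ∘ fun x => c₁ x j • u x) k,
            mFourierCoeff (FunctionSpaces.EuclideanSpace.complexify ∘ v) k⟫_ℂ -
          ⟪mFourierCoeff (FunctionSpaces.EuclideanSpace.complexify ∘ u) k,
            mFourierCoeff (FunctionSpaces.EuclideanSpace.complexify ∘ fun x => c₂ x j • v x) k⟫_ℂ)).re =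
      (∫ x, ⟪u x, FunctionSpaces.Torus.convect c₁ (FunctionSpaces.Torus.fourierTruncate N v) x⟫_ℝ) +
        ∫ x, ⟪v x, FunctionSpaces.Torus.convect c₂ (FunctionSpaces.Torus.fourierTruncate N u) x⟫_ℝ := by
  rw [integral_inner_convect_fourierTruncate_eq_sum hcu v N,
    integral_inner_convect_fourierTruncate_eq_sum hcv u N, ← Finset.sum_add_distrib]
  refine Finset.sum_congr rfl fun k _ => ?_
  rw [← Complex.add_re]
  simp only [mul_sub, Finset.sum_sub_distrib, Complex.sub_re, Complex.add_re, Complex.re_sum]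
  rw [sub_eq_add_neg, ← Finset.sum_neg_distrib]
  congr 1
  refine Finset.sum_congr rfl fun j _ => ?_
  rw [← inner_conj_symm, show (2 * (Real.pi : ℂ) * I * (k j : ℂ)) = ((2 * Real.pi * (k j : ℝ) : ℝ) : ℂ) * I by
    push_cast; ring, re_mul_I_mul_conj_eq_neg, neg_neg]

omit [DecidableEq d] in
/-- **The two-carrier mode family is summable** for bounded measurable carriers and `u, v ∈ L²` with
`H¹` Fourier sums (termwise AM–GM bound as in `summable_re_fourierFlux`; Parseval for `c₁ⱼu, c₂ⱼv ∈ L²`).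
[cite: RobinsonRodrigoSadowski2016, §4.1] -/
theorem summable_re_fourierFlux₂ {c₁ c₂ u v : UnitAddTorus d → EuclideanSpace ℝ d} {M₁ M₂ : ℝ}
    (hc₁M : ∀ x, ‖c₁ x‖ ≤ M₁) (hc₁ : Measurable c₁) (hc₂M : ∀ x, ‖c₂ x‖ ≤ M₂) (hc₂ : Measurable c₂)
    (hu : MemLp u 2 volume) (hv : MemLp v 2 volume)
    (hu1 : Summable fun k : d → ℤ =>
      FunctionSpaces.Torus.freqNormSq k * ‖mFourierCoeff (FunctionSpaces.EuclideanSpace.complexify ∘ u) k‖ ^ 2)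
    (hv1 : Summable fun k : d → ℤ =>
      FunctionSpaces.Torus.freqNormSq k * ‖mFourierCoeff (FunctionSpaces.EuclideanSpace.complexify ∘ v) k‖ ^ 2) :
    Summable fun k : d → ℤ => (∑ j, (2 * Real.pi * I * (k j)) *
        (⟪mFourierCoeff (FunctionSpaces.EuclideanSpace.complexify ∘ fun x => c₁ x j • u x) k,
            mFourierCoeff (FunctionSpaces.EuclideanSpace.complexify ∘ v) k⟫_ℂ -
          ⟪mFourierCoeff (FunctionSpaces.EuclideanSpace.complexify ∘ u) k,
            mFourierCoeff (FunctionSpaces.EuclideanSpace.complexify ∘ fun x => c₂ x j • v x) k⟫_ℂ)).re := by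
  -- notation
  set Fu : (d → ℤ) → EuclideanSpace ℂ d := fun k => mFourierCoeff (FunctionSpaces.EuclideanSpace.complexify ∘ u) k
    with hFu
  set Fv : (d → ℤ) → EuclideanSpace ℂ d := fun k => mFourierCoeff (FunctionSpaces.EuclideanSpace.complexify ∘ v) k
    with hFv
  set Fcu : d → (d → ℤ) → EuclideanSpace ℂ d := fun j k =>
    mFourierCoeff (FunctionSpaces.EuclideanSpace.complexify ∘ fun x => c₁ x j • u x) k with hFcu
  set Fcv : d → (d → ℤ) → EuclideanSpace ℂ d := fun j k =>
    mFourierCoeff (FunctionSpaces.EuclideanSpace.complexify ∘ fun x => c₂ x j • v x) k with hFcv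
  -- the dominating family
  set g : (d → ℤ) → ℝ := fun k => Real.pi * ∑ j, (((k j : ℝ) ^ 2 * ‖Fv k‖ ^ 2 + ‖Fcu j k‖ ^ 2) +
    ((k j : ℝ) ^ 2 * ‖Fu k‖ ^ 2 + ‖Fcv j k‖ ^ 2)) with hg
  have hPu : ∀ j, Summable fun k : d → ℤ => ‖Fcu j k‖ ^ 2 := fun j =>
    (FunctionSpaces.Torus.hasSum_sq_norm_mFourierCoeff_complexify
      (memLp_two_smul_apply_of_norm_le hc₁M hc₁ hu j)).summable
  have hPv : ∀ j, Summable fun k : d → ℤ => ‖Fcv j k‖ ^ 2 := fun j =>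
    (FunctionSpaces.Torus.hasSum_sq_norm_mFourierCoeff_complexify
      (memLp_two_smul_apply_of_norm_le hc₂M hc₂ hv j)).summable
  have hku : ∀ j, Summable fun k : d → ℤ => (k j : ℝ) ^ 2 * ‖Fu k‖ ^ 2 := by
    intro j
    refine hu1.of_nonneg_of_le (fun k => by positivity) fun k => ?_
    refine mul_le_mul_of_nonneg_right ?_ (sq_nonneg _)
    exact Finset.single_le_sum (f := fun i => ((k i : ℝ)) ^ 2) (fun i _ => sq_nonneg _) (Finset.mem_univ j)
  have hkv : ∀ j, Summable fun k : d → ℤ => (k j : ℝ) ^ 2 * ‖Fv k‖ ^ 2 := by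
    intro j
    refine hv1.of_nonneg_of_le (fun k => by positivity) fun k => ?_
    refine mul_le_mul_of_nonneg_right ?_ (sq_nonneg _)
    exact Finset.single_le_sum (f := fun i => ((k i : ℝ)) ^ 2) (fun i _ => sq_nonneg _) (Finset.mem_univ j)
  have hgs : Summable g := by
    refine (summable_sum fun j _ => ((hkv j).add (hPu j)).add ((hku j).add (hPv j))).mul_left Real.pi
  refine Summable.of_norm_bounded hgs fun k => ?_
  rw [Real.norm_eq_abs, Complex.re_sum]
  refine (Finset.abs_sum_le_sum_abs _ _).trans ?_
  simp only [hg, Finset.mul_sum]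
  refine Finset.sum_le_sum fun j _ => ?_
  rw [mul_sub, Complex.sub_re]
  refine (abs_sub _ _).trans ?_
  have h1 := abs_re_two_pi_I_mul_inner_le ((k j : ℤ) : ℝ) (Fcu j k) (Fv k)
  have h2 := abs_re_two_pi_I_mul_inner_le ((k j : ℤ) : ℝ) (Fu k) (Fcv j k)
  have e1 : ((((k j : ℤ) : ℝ) : ℂ)) = ((k j : ℤ) : ℂ) := by norm_cast
  rw [e1] at h1 h2
  refine (add_le_add h1 h2).trans ?_
  have am1 : 2 * Real.pi * |((k j : ℤ) : ℝ)| * ‖Fcu j k‖ * ‖Fv k‖ ≤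
      Real.pi * (((k j : ℝ)) ^ 2 * ‖Fv k‖ ^ 2 + ‖Fcu j k‖ ^ 2) := by
    have := two_mul_le_add_sq (|((k j : ℤ) : ℝ)| * ‖Fv k‖) ‖Fcu j k‖
    rw [mul_pow, sq_abs] at this
    nlinarith [Real.pi_pos, this]
  have am2 : 2 * Real.pi * |((k j : ℤ) : ℝ)| * ‖Fu k‖ * ‖Fcv j k‖ ≤
      Real.pi * (((k j : ℝ)) ^ 2 * ‖Fu k‖ ^ 2 + ‖Fcv j k‖ ^ 2) := by
    have := two_mul_le_add_sq (|((k j : ℤ) : ℝ)| * ‖Fu k‖) ‖Fcv j k‖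
    rw [mul_pow, sq_abs] at this
    nlinarith [Real.pi_pos, this]
  linarith

/-- **Partial sums of the two-carrier flux converge to its sum**: along the frequency balls,
`∫⟪u,(c₁·∇)P_N v⟫ + ∫⟪v,(c₂·∇)P_N u⟫ → ∑ₖ Re ∑ⱼ 2πikⱼ(⟪𝓕(c₁ⱼu),v̂⟫ − ⟪û,𝓕(c₂ⱼv)⟫)` (absolute
convergence, `summable_re_fourierFlux₂`, and `tendsto_freqBall_atTop`). [cite: RobinsonRodrigoSadowski2016, §4.1–§4.2] -/
theorem tendsto_sum_re_fourierFlux₂ {c₁ c₂ u v : UnitAddTorus d → EuclideanSpace ℝ d} {M₁ M₂ : ℝ}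
    (hc₁M : ∀ x, ‖c₁ x‖ ≤ M₁) (hc₁ : Measurable c₁) (hc₂M : ∀ x, ‖c₂ x‖ ≤ M₂) (hc₂ : Measurable c₂)
    (hu : MemLp u 2 volume) (hv : MemLp v 2 volume)
    (hu1 : Summable fun k : d → ℤ =>
      FunctionSpaces.Torus.freqNormSq k * ‖mFourierCoeff (FunctionSpaces.EuclideanSpace.complexify ∘ u) k‖ ^ 2)
    (hv1 : Summable fun k : d → ℤ =>
      FunctionSpaces.Torus.freqNormSq k * ‖mFourierCoeff (FunctionSpaces.EuclideanSpace.complexify ∘ v) k‖ ^ 2) :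
    Tendsto (fun N => (∫ x, ⟪u x, FunctionSpaces.Torus.convect c₁ (FunctionSpaces.Torus.fourierTruncate N v) x⟫_ℝ) +
        ∫ x, ⟪v x, FunctionSpaces.Torus.convect c₂ (FunctionSpaces.Torus.fourierTruncate N u) x⟫_ℝ) atTop
      (𝓝 (∑' k : d → ℤ, (∑ j, (2 * Real.pi * I * (k j)) *
        (⟪mFourierCoeff (FunctionSpaces.EuclideanSpace.complexify ∘ fun x => c₁ x j • u x) k,
            mFourierCoeff (FunctionSpaces.EuclideanSpace.complexify ∘ v) k⟫_ℂ -
          ⟪mFourierCoeff (FunctionSpaces.EuclideanSpace.complexify ∘ u) k,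
            mFourierCoeff (FunctionSpaces.EuclideanSpace.complexify ∘ fun x => c₂ x j • v x) k⟫_ℂ)).re)) := by
  have hs := summable_re_fourierFlux₂ hc₁M hc₁ hc₂M hc₂ hu hv hu1 hv1
  have hlim := hs.hasSum.comp FunctionSpaces.Torus.tendsto_freqBall_atTop
  refine hlim.congr fun N => ?_
  rw [Function.comp_apply, sum_re_fourierFlux₂_eq (integrable_smul_apply_of_norm_le hc₁M hc₁ hu)
    (integrable_smul_apply_of_norm_le hc₂M hc₂ hv) N]

end TwoCarriers

end Torus

end Literature.Analysis.FluidPDE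

end
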